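import Literature.NumberTheory.Transcendental.HolonomyBoundEstimate
import Mathlib.RingTheory.PowerSeries.Basic
import Mathlib.Tactic
import HarnessLib

/-!
# The basic arithmetic holonomy bound, IV-a: the auxiliary functions `V = Σ Qᵢ(φ) gᵢ`

Calegari–Dimitrov–Tang, arXiv:2408.15403, Appendix §17.3 (p. 130): for an output function
`F(x) = Σᵢ Qᵢ(x) fᵢ(x)` of the box `𝓘_D(T)` (or a difference of two of them: `Qᵢ ∈ ℤ[x]_{<D}` with
coefficients bounded by `T`), the function `V(z) := Σᵢ Qᵢ(φ(z)) · (φ^*fᵢ)(z)` is holomorphic on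
a neighbourhood of the closed unit disc, its germ at `0` is `F(φ(z)) = Σ_N β_N φ(z)^N` with
`β_N` the Taylor coefficients of `F`, and on the unit circle
`|V| ≤ T · (sup_𝕋 max(1,|φ|))^D · mD · sup_𝕋 |φ^* fᵢ|` (eq. (sup bound), second line; here
`u = h = 1`). Combined with the Cauchy estimate of `HolonomyBoundEstimate.lean` this gives the
bound `A_p` of §17.3.

Everything is phrased for the `ℚ`-linear combinations
`W c = Σᵢ Σ_{j<D} c i j • (X^j · fᵢ)`, `fᵢ = PowerSeries.mk (cf i)`, which is the same thing as
`Σᵢ Qᵢ fᵢ` with `Qᵢ = Σⱼ c i j xʲ`.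

## Contents (all proved; no named facts)

* `HolonomyBound.combo`, `HolonomyBound.coeff_combo` — `W c` and its coefficients
  `coeff_N (W c) = Σᵢ Σ_{j ≤ N} c i j · cf i (N − j)`.
* `HolonomyBound.auxV`, `HolonomyBound.differentiableOn_auxV`, `HolonomyBound.hasSum_auxV`,
  `HolonomyBound.norm_auxV_le` — `V`, its holomorphy, its germ, its bound on `|z| = 1`.
* `HolonomyBound.norm_coeff_combo_mul_pow_le` — **the bound `A_p`**: if the coefficients of
  `W c` below `n` vanish and `|c i j| ≤ T`, then `‖coeff_n (W c)‖ · ‖φ'(0)‖ⁿ ≤ m·T·D·M^D·G`.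

## References

* [CalegariDimitrovTang2024] arXiv:2408.15403, Appendix §17.3, eq. (sup bound) (p. 130).
-/

noncomputable section

open Filter Metric Finset PowerSeries
open scoped Topology

namespace Literature.NumberTheory.Transcendental

namespace HolonomyBound

variable {m D : ℕ}

/-! ### The combinations `W c = Σ c i j • X^j fᵢ` and their coefficients -/

/-- The `ℚ`-linear combination `W c = Σᵢ Σ_{j<D} c i j • (X^j · fᵢ)` with `fᵢ = mk (cf i)`
(`= Σᵢ Qᵢ fᵢ`, `Qᵢ = Σⱼ c i j xʲ`; CDT's evaluation map `ψ_D`).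
[cite: CalegariDimitrovTang2024, Appendix §17.1 eq. (eval) (p. 129)] -/
def combo (cf : Fin m → ℕ → ℚ) (c : Fin m → Fin D → ℚ) : PowerSeries ℚ :=
  ∑ i : Fin m, ∑ j : Fin D, c i j • ((X : PowerSeries ℚ) ^ (j : ℕ) * PowerSeries.mk (cf i))

/-- Coefficients of `W c`: `coeff_N (W c) = Σᵢ Σ_{j ≤ N} c i j · cf i (N − j)`. [folklore] -/
theorem coeff_combo (cf : Fin m → ℕ → ℚ) (c : Fin m → Fin D → ℚ) (N : ℕ) :
    coeff N (combo cf c) =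
      ∑ i : Fin m, ∑ j : Fin D, if (j : ℕ) ≤ N then c i j * cf i (N - j) else 0 := by
  simp only [combo, map_sum, map_smul, coeff_X_pow_mul', coeff_mk, smul_eq_mul, mul_ite,
    mul_zero]

/-! ### The auxiliary function `V` -/

/-- `V(z) = Σᵢ (Σⱼ c i j φ(z)ʲ) · gᵢ(z)` (CDT's `V = h u^D (F₁(φ) − F₂(φ))` with `u = h = 1`).
[cite: CalegariDimitrovTang2024, Appendix §17.3 (p. 130)] -/
def auxV (c : Fin m → Fin D → ℚ) (φ : ℂ → ℂ) (g : Fin m → ℂ → ℂ) (z : ℂ) : ℂ :=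
  ∑ i : Fin m, (∑ j : Fin D, (c i j : ℂ) * φ z ^ (j : ℕ)) * g i z

/-- `V` is holomorphic where `φ` and the `gᵢ` are. [folklore] -/
theorem differentiableOn_auxV (c : Fin m → Fin D → ℚ) {φ : ℂ → ℂ} {g : Fin m → ℂ → ℂ}
    {s : Set ℂ} (hφ : DifferentiableOn ℂ φ s) (hg : ∀ i, DifferentiableOn ℂ (g i) s) :
    DifferentiableOn ℂ (auxV c φ g) s := by
  unfold auxV
  refine DifferentiableOn.fun_sum fun i _ => DifferentiableOn.mul ?_ (hg i)
  exact DifferentiableOn.fun_sum fun j _ => (hφ.pow _).const_mul _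

/-- **The germ of `V` is `F ∘ φ`**: if `gᵢ(z) = Σ_k cf i k · φ(z)^k` near `0` for each `i`, then
`V(z) = Σ_N (coeff_N (W c)) · φ(z)^N` near `0`. [folklore] -/
theorem hasSum_auxV (cf : Fin m → ℕ → ℚ) (c : Fin m → Fin D → ℚ) {φ : ℂ → ℂ}
    {g : Fin m → ℂ → ℂ}
    (hgerm : ∀ i, ∀ᶠ z in 𝓝 (0 : ℂ), HasSum (fun k => (cf i k : ℂ) * φ z ^ k) (g i z)) :
    ∀ᶠ z in 𝓝 (0 : ℂ),
      HasSum (fun N => ((coeff N (combo cf c) : ℚ) : ℂ) * φ z ^ N) (auxV c φ g z) := by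
  have hall : ∀ᶠ z in 𝓝 (0 : ℂ), ∀ i, HasSum (fun k => (cf i k : ℂ) * φ z ^ k) (g i z) :=
    eventually_all.mpr hgerm
  filter_upwards [hall] with z hz
  -- one shifted series for each `(i, j)`
  have hij : ∀ (i : Fin m) (j : Fin D),
      HasSum (fun N => if (j : ℕ) ≤ N then (c i j : ℂ) * (cf i (N - j) : ℂ) * φ z ^ N else 0)
        ((c i j : ℂ) * φ z ^ (j : ℕ) * g i z) := by
    intro i j
    have h1 : HasSum (fun k => (c i j : ℂ) * φ z ^ (j : ℕ) * ((cf i k : ℂ) * φ z ^ k))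
        ((c i j : ℂ) * φ z ^ (j : ℕ) * g i z) := (hz i).mul_left _
    rw [← hasSum_nat_add_iff' (j : ℕ)]
    have hzero : ∑ N ∈ range (j : ℕ),
        (if (j : ℕ) ≤ N then (c i j : ℂ) * (cf i (N - j) : ℂ) * φ z ^ N else 0) = 0 :=
      Finset.sum_eq_zero fun N hN => if_neg (not_le.mpr (Finset.mem_range.mp hN))
    rw [hzero, sub_zero]
    have hfun : (fun k => if (j : ℕ) ≤ k + j then (c i j : ℂ) * (cf i (k + j - j) : ℂ) *
        φ z ^ (k + j) else 0) =
        fun k => (c i j : ℂ) * φ z ^ (j : ℕ) * ((cf i k : ℂ) * φ z ^ k) := by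
      funext k
      rw [if_pos (Nat.le_add_left _ _), Nat.add_sub_cancel, pow_add]
      ring
    rw [hfun]
    exact h1
  -- sum over `(i, j)`
  have hsum : HasSum (fun N => ∑ i : Fin m, ∑ j : Fin D,
      if (j : ℕ) ≤ N then (c i j : ℂ) * (cf i (N - j) : ℂ) * φ z ^ N else 0)
      (∑ i : Fin m, ∑ j : Fin D, (c i j : ℂ) * φ z ^ (j : ℕ) * g i z) :=
    hasSum_sum fun i _ => hasSum_sum fun j _ => hij i j
  have hval : (∑ i : Fin m, ∑ j : Fin D, (c i j : ℂ) * φ z ^ (j : ℕ) * g i z) = auxV c φ g z := by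
    simp only [auxV, Finset.sum_mul]
  rw [hval] at hsum
  have hfun : (fun N => ((coeff N (combo cf c) : ℚ) : ℂ) * φ z ^ N) = fun N =>
      ∑ i : Fin m, ∑ j : Fin D,
        if (j : ℕ) ≤ N then (c i j : ℂ) * (cf i (N - j) : ℂ) * φ z ^ N else 0 := by
    funext N
    rw [coeff_combo, Rat.cast_sum, Finset.sum_mul]
    refine Finset.sum_congr rfl fun i _ => ?_
    rw [Rat.cast_sum, Finset.sum_mul]
    refine Finset.sum_congr rfl fun j _ => ?_
    split_ifs with h
    · push_cast; ring
    · rw [Rat.cast_zero, zero_mul]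
  rw [hfun]
  exact hsum

/-- **The bound on the unit circle** (CDT eq. (sup bound), second line, with `u = h = 1`): if
`|c i j| ≤ T`, `|φ(z)| ≤ M` with `M ≥ 1` and `|gᵢ(z)| ≤ G`, then `|V(z)| ≤ m·T·D·M^D·G`.
[cite: CalegariDimitrovTang2024, Appendix §17.3 eq. (sup bound) (p. 130)] -/
theorem norm_auxV_le (c : Fin m → Fin D → ℚ) {φ : ℂ → ℂ} {g : Fin m → ℂ → ℂ} {T M G : ℝ}
    (hT : ∀ i j, |(c i j : ℝ)| ≤ T) (hM1 : 1 ≤ M) {z : ℂ} (hφz : ‖φ z‖ ≤ M)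
    (hgz : ∀ i, ‖g i z‖ ≤ G) : ‖auxV c φ g z‖ ≤ m * T * D * M ^ D * G := by
  have hM0 : 0 ≤ M := le_trans zero_le_one hM1
  -- the polynomial factor
  have hpoly : ∀ i, ‖∑ j : Fin D, (c i j : ℂ) * φ z ^ (j : ℕ)‖ ≤ D * T * M ^ D := by
    intro i
    calc ‖∑ j : Fin D, (c i j : ℂ) * φ z ^ (j : ℕ)‖
        ≤ ∑ j : Fin D, ‖(c i j : ℂ) * φ z ^ (j : ℕ)‖ := norm_sum_le _ _
      _ ≤ ∑ _j : Fin D, T * M ^ D := Finset.sum_le_sum fun j _ => by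
          rw [norm_mul, norm_pow, Complex.norm_ratCast]
          have h1 : |(c i j : ℝ)| ≤ T := hT i j
          have h2 : ‖φ z‖ ^ (j : ℕ) ≤ M ^ D :=
            le_trans (pow_le_pow_left₀ (norm_nonneg _) hφz _)
              (pow_le_pow_right₀ hM1 (le_of_lt j.isLt))
          exact mul_le_mul h1 h2 (by positivity) (le_trans (abs_nonneg _) h1)
      _ = D * T * M ^ D := by
          rw [Finset.sum_const, Finset.card_univ, Fintype.card_fin, nsmul_eq_mul]; ring
  unfold auxV
  calc ‖∑ i : Fin m, (∑ j : Fin D, (c i j : ℂ) * φ z ^ (j : ℕ)) * g i z‖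
      ≤ ∑ i : Fin m, ‖(∑ j : Fin D, (c i j : ℂ) * φ z ^ (j : ℕ)) * g i z‖ := norm_sum_le _ _
    _ ≤ ∑ _i : Fin m, (D * T * M ^ D) * G := Finset.sum_le_sum fun i _ => by
        rw [norm_mul]
        exact mul_le_mul (hpoly i) (hgz i) (norm_nonneg _)
          (le_trans (norm_nonneg _) (hpoly i))
    _ = m * T * D * M ^ D * G := by
        rw [Finset.sum_const, Finset.card_univ, Fintype.card_fin, nsmul_eq_mul]; ring

/-- **The bound `A_p` of CDT §17.3** (holomorphic case): let `fᵢ = mk (cf i)` with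
`gᵢ = φ^* fᵢ` holomorphic on `|z| < R₀` (`R₀ > 1`), i.e. `gᵢ(z) = Σ_k cf i k φ(z)^k` near `0`,
`φ` holomorphic there with `φ(0) = 0`, `|φ| ≤ M` (`M ≥ 1`) and `|gᵢ| ≤ G` on `|z| = 1`. If
`|c i j| ≤ T` and the combination `W c = Σ c i j • X^j fᵢ` vanishes to order `≥ n` at `0`,
then its `n`-th coefficient `β` satisfies `‖β‖ · ‖φ'(0)‖ⁿ ≤ m·T·D·M^D·G`.
[cite: CalegariDimitrovTang2024, Appendix §17.3 eq. (sup bound) (p. 130)] -/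
theorem norm_coeff_combo_mul_pow_le (cf : Fin m → ℕ → ℚ) (c : Fin m → Fin D → ℚ)
    {φ : ℂ → ℂ} {g : Fin m → ℂ → ℂ} {R₀ T M G : ℝ} (hR₀ : 1 < R₀)
    (hφ : DifferentiableOn ℂ φ (ball (0 : ℂ) R₀)) (hφ0 : φ 0 = 0)
    (hg : ∀ i, DifferentiableOn ℂ (g i) (ball (0 : ℂ) R₀))
    (hgerm : ∀ i, ∀ᶠ z in 𝓝 (0 : ℂ), HasSum (fun k => (cf i k : ℂ) * φ z ^ k) (g i z))
    (hT : ∀ i j, |(c i j : ℝ)| ≤ T) (hM1 : 1 ≤ M) (hM : ∀ z : ℂ, ‖z‖ = 1 → ‖φ z‖ ≤ M)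
    (hGz : ∀ i (z : ℂ), ‖z‖ = 1 → ‖g i z‖ ≤ G)
    {n : ℕ} (hn : ∀ k < n, coeff k (combo cf c) = 0) :
    ‖((coeff n (combo cf c) : ℚ) : ℂ)‖ * ‖deriv φ 0‖ ^ n ≤ m * T * D * M ^ D * G :=
  norm_coeff_mul_pow_le (β := fun k => ((coeff k (combo cf c) : ℚ) : ℂ))
    (fun k hk => by simp only [hn k hk, Rat.cast_zero]) hR₀ hφ hφ0
    (differentiableOn_auxV c hφ hg) (hasSum_auxV cf c hgerm)
    (fun z hz => norm_auxV_le c hT hM1 (hM z hz) fun i => hGz i z hz)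

end HolonomyBound

end Literature.NumberTheory.Transcendental
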